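/-
Copyright (c) 2026 The HCML crux team. All rights reserved.
Released under Apache 2.0 license as described in the file LICENSE.
Authors: K2E3-p11 (g6) (explicit-unit `hodgecm-mathlib-K2E3-p11-g6`; dealer K2E3-plan (g4) D74, line «IH-x×x×x» lead) — brick IH-4 of architect K2E3-p25 (g0)'s route (H)
-/
import Mathlib.Data.Matrix.Basic
import Mathlib.LinearAlgebra.Matrix.Notation
import Mathlib.Algebra.BigOperators.Fin
import Mathlib.Tactic.LinearCombination
import Mathlib.Tactic.FieldSimp
import HarnessLib

/-!
# (line «IH-x×x×x», IH-4) The Iwahori–Hecke module of `1×1×1` has scalar commutant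

Cell `hodgecm-mathlib`, Track B, line `K2_E3_EllipticInputs`; road (11-3-split-nsc), leaf (nsc-S-A′) `sig_K2E3GL3PrincipalBlockStandardSpan` (owner K2E3-p25 (g0), road «EXP»),
H-layer residue R1 «`x×x×x` is irreducible» (MEMO-H4-residues v1 e2c901f5 §2), route (H) = line «IH-x×x×x» (dealer K2E3-plan (g4) RULINGS #2 (R-5), D74 lead K2E3-p11 (g6)):
IH-1 Bruhat–Iwahori cells ∥ IH-3 `Iw`-fixed vectors of constituents; IH-2 the operators `T_{s₁}, T_{s₂}, R` on `I^{Iw}` (`I = 1×1×1 = Ind_B^{GL₃(F)} δ^{1∕2}`);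
**IH-4 (this file)**; IH-5 assembly (`End_G(I) = ℂ` ⇒ irreducible by unitarity).

THE MATHEMATICS.  `I^{Iw}` is 6-dimensional; in the basis `ψ_w` (`w ∈ S₃`, ordered `e, s₂, s₁, s₁s₂, s₂s₁, w₀`) the Iwahori–Hecke operators of the two finite
simple reflections act by the LEFT REGULAR representation of the finite Hecke algebra `H_W` (`T_s ψ_w = ψ_{sw}` if `ℓ(sw) > ℓ(w)`, else `(q−1)ψ_w + q ψ_{sw}`,
`q = #k_F`) and the length-zero element `r = [[0,1,0],[0,0,1],[ϖ,0,0]]` (normalising `Iw`) by the weighted double 3-cycle `P` below — the Bernstein–Lusztig model of the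
EXTENDED affine Hecke algebra of `GL₃` on `H̃ ⊗_{ℂ[θ]} ℂ_{t = (1,1,1)}` (lead's check `K2/K2E3-p11/g6/IH4_check.v1.K2E3-p11-g6.md`: all Iwahori–Matsumoto relations hold,
`P³ = 1`, `P T_{s₁} P⁻¹ = T_{s₂}`).  `T_{s₁}, T_{s₂}` alone give the regular `H_W`-module (commutant of dimension 6); with `P` the commutant is the scalars,
uniformly in `q ≠ 0, 1` — this is IH-4, a LINEAR statement (no invariant-subspace search, no `decide`):

**`eq_smul_one_of_commute`**: over any field `K`, for `q ∈ K ∖ {0,1}` and the three explicit matrices `T₁, T₂, P`, every `X` with `X T₁ = T₁ X`, `X T₂ = T₂ X`,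
`X P = P X` equals `(X 0 0) • 1`.

PROOF (6 unknowns, not 36).  Commuting with `T₁, T₂` makes every column of `X` a word in `T₁, T₂` applied to column `0` (`a := X · 0`): `X·ψ_{sw} = T_s (X·ψ_w)`
because `ψ_{sw} = T_s ψ_w` when `ℓ(sw) > ℓ(w)` (columns `1 = T₂·0`, `2 = T₁·0`, `3 = T₁·1`, `4 = T₂·2`, `5 = T₁·4`).  Five entries of `X P = P X` — positions
`(2,0), (4,0), (3,0), (3,1), (2,1)` — then read `(q−1)a₄ = 0`, `(q−1)a₅ = 0`, `(q−1)(a₁ + q a₅) = 0`, `(q−1)a₃ = 0`, `(q−1)(a₂ − a₁) = 0`, so `a = a₀ e₀` and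
every column `w` of `X` is `a₀ e_w`.  Only `q ≠ 1` and `q ≠ 0` are used (the module degenerates exactly at `q = 1`: commutant of dimension 6 there).

HONEST LABEL: HC_CM is proved only modulo the 7 printed citations (2 remaining named inputs: hLiu418 = stmt-HodgeConjecture-24832, h413 =
stmt-HodgeConjecture-24833) until rung 0 closes; count-neutral (kernel lane `--supports stmt-HodgeConjecture-24833 --as helper`), THEOREMS ONLY (the three matrices are
hypotheses `hT₁ hT₂ hP : _ = !![…]`, instantiated by `rfl` in IH-2∕IH-5; no `def`).

References: Iwahori–Matsumoto 1965 §3 (the presentation of `H(G, Iw)`; the Bernstein–Lusztig form is Lusztig, J. AMS 2 (1989) Prop. 3.6) [cite: IwahoriMatsumoto1965, §3];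
Borel 1976 §4 and Casselman 1980 §3 (the `Iw`-fixed-vector functor and the unramified principal series; Kato's irreducibility criterion, J. Fac. Sci. Tokyo 28 (1982)
Thm. 2.2, predicts the result: `e^α(t) = 1 ≠ q^{±1}`, `W_t = W`) [cite: Borel1976, §4] [cite: Casselman1980, §3].
-/

open Matrix

set_option linter.dupNamespace false

namespace Summit.HodgeConjecture.HodgeConjecture.Cruxes.H413.K2E3GL3IwahoriModuleIrreducible

/-! ## §1 IH-4: the common commutant of `T₁, T₂, P` is `K · 1` -/

section Main

variable {K : Type*} [Field K]

/-- **(IH-4) THE IWAHORI–HECKE MODULE OF `1×1×1` HAS SCALAR COMMUTANT**, uniformly in `q ≠ 0, 1`: for the left-regular matrices `T₁, T₂` of the finite Hecke algebra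
of `S₃` (basis `e, s₂, s₁, s₁s₂, s₂s₁, w₀`) and the weighted double 3-cycle `P` of the length-zero generator at Satake parameter `(1,1,1)`, every matrix commuting
with `T₁`, `T₂` and `P` is scalar. [cite: IwahoriMatsumoto1965, §3] [cite: Casselman1980, §3] [cite: Borel1976, §4] -/
theorem eq_smul_one_of_commute {q : K} (hq0 : q ≠ 0) (hq1 : q ≠ 1) {T₁ T₂ P X : Matrix (Fin 6) (Fin 6) K}
    (hT₁ : T₁ = !![0, 0, q, 0, 0, 0; 0, 0, 0, q, 0, 0; 1, 0, q - 1, 0, 0, 0; 0, 1, 0, q - 1, 0, 0; 0, 0, 0, 0, 0, q; 0, 0, 0, 0, 1, q - 1])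
    (hT₂ : T₂ = !![0, q, 0, 0, 0, 0; 1, q - 1, 0, 0, 0, 0; 0, 0, 0, 0, q, 0; 0, 0, 0, 0, 0, q; 0, 0, 1, 0, q - 1, 0; 0, 0, 0, 1, 0, q - 1])
    (hP : P = !![0, 0, 0, 0, q, 0; 0, 0, 0, 0, 0, q; 0, 1, 0, 0, 0, 0; q⁻¹, 0, 0, 0, 0, 0; 0, 0, 0, 1, 0, 0; 0, 0, q⁻¹, 0, 0, 0])
    (h₁ : X * T₁ = T₁ * X) (h₂ : X * T₂ = T₂ * X) (hPX : X * P = P * X) :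
    X = X 0 0 • (1 : Matrix (Fin 6) (Fin 6) K) := by
  subst hT₁ hT₂ hP
  have hq1' : q - 1 ≠ 0 := sub_ne_zero.2 hq1
  have ent : ∀ {A B : Matrix (Fin 6) (Fin 6) K}, A = B → ∀ i j, A i j = B i j := fun h i j => by rw [h]
  -- §1 the entries of columns 1, 2, 3 that the five `P`-equations see, through column 0 (`a_k = X k 0`)
  have X01 : X 0 1 = q * X 1 0 := by
    have h := ent h₂ 0 0; simp [Matrix.mul_apply, Fin.sum_univ_succ] at h; linear_combination h
  have X11 : X 1 1 = X 0 0 + (q - 1) * X 1 0 := by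
    have h := ent h₂ 1 0; simp [Matrix.mul_apply, Fin.sum_univ_succ] at h; linear_combination h
  have X21 : X 2 1 = q * X 4 0 := by
    have h := ent h₂ 2 0; simp [Matrix.mul_apply, Fin.sum_univ_succ] at h; linear_combination h
  have X31 : X 3 1 = q * X 5 0 := by
    have h := ent h₂ 3 0; simp [Matrix.mul_apply, Fin.sum_univ_succ] at h; linear_combination h
  have X51 : X 5 1 = X 3 0 + (q - 1) * X 5 0 := by
    have h := ent h₂ 5 0; simp [Matrix.mul_apply, Fin.sum_univ_succ] at h; linear_combination h
  have X22 : X 2 2 = X 0 0 + (q - 1) * X 2 0 := by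
    have h := ent h₁ 2 0; simp [Matrix.mul_apply, Fin.sum_univ_succ] at h; linear_combination h
  have X32 : X 3 2 = X 1 0 + (q - 1) * X 3 0 := by
    have h := ent h₁ 3 0; simp [Matrix.mul_apply, Fin.sum_univ_succ] at h; linear_combination h
  have X23 : X 2 3 = X 0 1 + (q - 1) * X 2 1 := by
    have h := ent h₁ 2 1; simp [Matrix.mul_apply, Fin.sum_univ_succ] at h; linear_combination h
  have X33 : X 3 3 = X 1 1 + (q - 1) * X 3 1 := by
    have h := ent h₁ 3 1; simp [Matrix.mul_apply, Fin.sum_univ_succ] at h; linear_combination h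
  have X43 : X 4 3 = q * X 5 1 := by
    have h := ent h₁ 4 1; simp [Matrix.mul_apply, Fin.sum_univ_succ] at h; linear_combination h
  -- §2 the five `P`-equations, positions `(2,0), (4,0), (3,0), (3,1), (2,1)`
  have P20 : X 2 3 = q * X 1 0 := by
    have h := ent hPX 2 0; simp [Matrix.mul_apply, Fin.sum_univ_succ] at h; field_simp at h; linear_combination h
  have P40 : X 4 3 = q * X 3 0 := by
    have h := ent hPX 4 0; simp [Matrix.mul_apply, Fin.sum_univ_succ] at h; field_simp at h; linear_combination h
  have P30 : X 3 3 = X 0 0 := by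
    have h := ent hPX 3 0; simp [Matrix.mul_apply, Fin.sum_univ_succ] at h; field_simp at h; linear_combination h
  have P31 : q * X 3 2 = X 0 1 := by
    have h := ent hPX 3 1; simp [Matrix.mul_apply, Fin.sum_univ_succ] at h; field_simp at h; linear_combination h
  have P21 : X 2 2 = X 1 1 := by
    have h := ent hPX 2 1; simp [Matrix.mul_apply, Fin.sum_univ_succ] at h; linear_combination h
  -- §3 `a₄ = a₅ = a₁ = a₃ = a₂ = 0`
  have a4 : X 4 0 = 0 := by
    have h : (q - 1) * (q * X 4 0) = 0 := by linear_combination P20 - X23 - X01 - (q - 1) * X21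
    rcases mul_eq_zero.1 h with h | h
    · exact absurd h hq1'
    · rcases mul_eq_zero.1 h with h | h
      · exact absurd h hq0
      · exact h
  have a5 : X 5 0 = 0 := by
    have h : (q - 1) * (q * X 5 0) = 0 := by linear_combination P40 - X43 - q * X51
    rcases mul_eq_zero.1 h with h | h
    · exact absurd h hq1'
    · rcases mul_eq_zero.1 h with h | h
      · exact absurd h hq0
      · exact h
  have a1 : X 1 0 = 0 := by
    have h : (q - 1) * X 1 0 = 0 := by linear_combination P30 - X33 - X11 - (q - 1) * X31 - (q - 1) * q * a5
    rcases mul_eq_zero.1 h with h | h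
    · exact absurd h hq1'
    · exact h
  have a3 : X 3 0 = 0 := by
    have h : (q - 1) * (q * X 3 0) = 0 := by linear_combination P31 - q * X32 + X01
    rcases mul_eq_zero.1 h with h | h
    · exact absurd h hq1'
    · rcases mul_eq_zero.1 h with h | h
      · exact absurd h hq0
      · exact h
  have a2 : X 2 0 = 0 := by
    have h : (q - 1) * X 2 0 = 0 := by linear_combination P21 - X22 + X11 + (q - 1) * a1
    rcases mul_eq_zero.1 h with h | h
    · exact absurd h hq1'
    · exact h
  -- §4 `D := X − (X 0 0) • 1` commutes with `T₁, T₂` and has zero column 0, hence is zero column by column (`ψ_{sw} = T_s ψ_w`)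
  set D : Matrix (Fin 6) (Fin 6) K := X - X 0 0 • (1 : Matrix (Fin 6) (Fin 6) K) with hD
  have hD₁ : D * !![0, 0, q, 0, 0, 0; 0, 0, 0, q, 0, 0; 1, 0, q - 1, 0, 0, 0; 0, 1, 0, q - 1, 0, 0; 0, 0, 0, 0, 0, q; 0, 0, 0, 0, 1, q - 1] =
      !![0, 0, q, 0, 0, 0; 0, 0, 0, q, 0, 0; 1, 0, q - 1, 0, 0, 0; 0, 1, 0, q - 1, 0, 0; 0, 0, 0, 0, 0, q; 0, 0, 0, 0, 1, q - 1] * D := by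
    rw [hD, Matrix.sub_mul, Matrix.mul_sub, h₁, Matrix.smul_mul, Matrix.mul_smul, Matrix.one_mul, Matrix.mul_one]
  have hD₂ : D * !![0, q, 0, 0, 0, 0; 1, q - 1, 0, 0, 0, 0; 0, 0, 0, 0, q, 0; 0, 0, 0, 0, 0, q; 0, 0, 1, 0, q - 1, 0; 0, 0, 0, 1, 0, q - 1] =
      !![0, q, 0, 0, 0, 0; 1, q - 1, 0, 0, 0, 0; 0, 0, 0, 0, q, 0; 0, 0, 0, 0, 0, q; 0, 0, 1, 0, q - 1, 0; 0, 0, 0, 1, 0, q - 1] * D := by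
    rw [hD, Matrix.sub_mul, Matrix.mul_sub, h₂, Matrix.smul_mul, Matrix.mul_smul, Matrix.one_mul, Matrix.mul_one]
  have d0 : ∀ k, D k 0 = 0 := by
    intro k
    fin_cases k
    · simp [hD]
    · simpa [hD] using a1
    · simpa [hD] using a2
    · simpa [hD] using a3
    · simpa [hD] using a4
    · simpa [hD] using a5
  have d1 : ∀ i, D i 1 = 0 := fun i => by
    have h := ent hD₂ i 0; simpa [Matrix.mul_apply, Fin.sum_univ_succ, d0] using h
  have d2 : ∀ i, D i 2 = 0 := fun i => by
    have h := ent hD₁ i 0; simpa [Matrix.mul_apply, Fin.sum_univ_succ, d0] using h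
  have d3 : ∀ i, D i 3 = 0 := fun i => by
    have h := ent hD₁ i 1; simpa [Matrix.mul_apply, Fin.sum_univ_succ, d1] using h
  have d4 : ∀ i, D i 4 = 0 := fun i => by
    have h := ent hD₂ i 2; simpa [Matrix.mul_apply, Fin.sum_univ_succ, d2] using h
  have d5 : ∀ i, D i 5 = 0 := fun i => by
    have h := ent hD₁ i 4; simpa [Matrix.mul_apply, Fin.sum_univ_succ, d4] using h
  have hD0 : D = 0 := by
    ext i j
    fin_cases j
    · exact d0 i
    · exact d1 i
    · exact d2 i
    · exact d3 i
    · exact d4 i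
    · exact d5 i
  have : X - X 0 0 • (1 : Matrix (Fin 6) (Fin 6) K) = 0 := hD ▸ hD0
  exact sub_eq_zero.1 this

end Main

end Summit.HodgeConjecture.HodgeConjecture.Cruxes.H413.K2E3GL3IwahoriModuleIrreducible
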